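import Literature.NumberTheory.Sieve.FordMaynardSliceConvolution
import Mathlib.MeasureTheory.Measure.Prod
import Mathlib.MeasureTheory.Group.Measure
import Mathlib.MeasureTheory.Measure.Lebesgue.EqHaar
import Mathlib.MeasureTheory.Measure.Haar.NormedSpace
import Mathlib.MeasureTheory.Measure.Haar.Unique
import Mathlib.GroupTheory.Perm.Sign
import HarnessLib

/-!
# Slice integrals are invariant under permutations of the coordinates

Companion of `FordMaynardSliceConvolution.lean` (everything PROVED). Ford–Maynard integrate over
subsets of hyperplanes `{x₁ + ⋯ + x_k = z}` "with respect to the projection measure onto the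
first `k − 1` coordinates", noting that "the choice of which `k − 1` coordinates to project onto
does not matter" (arXiv:2407.14368, §4.2). In the parametrisation of `sliceIntegral`
(`Literature/NumberTheory/Sieve/FordMaynardFramework.lean`: free coordinates `u ∈ ℝ^d`, last
coordinate `w − ∑ u`) this is the statement that `sliceIntegral (d+1) w (G ∘ (· ∘ σ)) =
sliceIntegral (d+1) w G` for every permutation `σ` of `Fin (d+1)` (`sliceIntegral_comp_perm`).

Proof: permutations are products of transpositions (`Equiv.Perm.swap_induction_on`); a swap of
two free coordinates is a coordinate permutation of `ℝ^d` (`volume_measurePreserving_piCongrLeft`);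
the swap of a free coordinate `x` with the dependent one is realised on the parameters by the
involution `T_{x,w}(u) = update u x (w − ∑ u)` (`sliceSwapMap`), which preserves Lebesgue measure
(`measurePreserving_sliceSwapMap`: after splitting off the coordinate `x` by `piFinSuccAbove` it
is the skew product `(v, t) ↦ (v, (w − ∑ v) − t)`, `MeasurePreserving.skew_product` with
`measurePreserving_sub_left`).

This is the symmetrisation tool for Ford–Maynard's Theorem 6.4 / Lemma 9.2-type identities.
-/

noncomputable section

open MeasureTheory Finset

namespace Literature.NumberTheory.Sieve.FordMaynard

section Perm

variable {n : ℕ}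

/-- The reflection-shear `T_{x,w}(u) = update u x (w − ∑ u)` on `ℝ^{n+1}`: exchanging the roles of
the coordinate `x` and of the dependent last coordinate `w − ∑ u` of a slice point. [folklore] -/
def sliceSwapMap (x : Fin (n + 1)) (w : ℝ) (u : Fin (n + 1) → ℝ) : Fin (n + 1) → ℝ :=
  Function.update u x (w - ∑ i, u i)

/-- `T_{x,w}(u)_x = w − ∑ u`. [folklore] -/
theorem sliceSwapMap_apply_self (x : Fin (n + 1)) (w : ℝ) (u : Fin (n + 1) → ℝ) :
    sliceSwapMap x w u x = w - ∑ i, u i := by simp [sliceSwapMap]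

/-- `T_{x,w}(u)_j = u_j` for `j ≠ x`. [folklore] -/
theorem sliceSwapMap_apply_ne (x : Fin (n + 1)) (w : ℝ) (u : Fin (n + 1) → ℝ) {j : Fin (n + 1)}
    (h : j ≠ x) : sliceSwapMap x w u j = u j := by simp [sliceSwapMap, h]

/-- `∑ T_{x,w}(u) = w − u_x`. [folklore] -/
theorem sum_sliceSwapMap (x : Fin (n + 1)) (w : ℝ) (u : Fin (n + 1) → ℝ) :
    ∑ i, sliceSwapMap x w u i = w - u x := by
  rw [← Finset.add_sum_erase _ _ (Finset.mem_univ x), sliceSwapMap_apply_self,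
    Finset.sum_congr rfl fun j hj => sliceSwapMap_apply_ne x w u (Finset.ne_of_mem_erase hj)]
  have := Finset.add_sum_erase Finset.univ u (Finset.mem_univ x)
  linarith

/-- `T_{x,w}` is an involution. [folklore] -/
theorem sliceSwapMap_involutive (x : Fin (n + 1)) (w : ℝ) :
    Function.Involutive (sliceSwapMap (n := n) x w) := by
  intro u
  funext j
  by_cases h : j = x
  · subst h; rw [sliceSwapMap_apply_self, sum_sliceSwapMap]; ring
  · rw [sliceSwapMap_apply_ne x w _ h, sliceSwapMap_apply_ne x w _ h]

/-- `T_{x,w}` is measurable. [folklore] -/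
theorem measurable_sliceSwapMap (x : Fin (n + 1)) (w : ℝ) : Measurable (sliceSwapMap (n := n) x w) := by
  refine measurable_pi_iff.2 fun j => ?_
  by_cases h : j = x
  · subst h
    simp only [sliceSwapMap_apply_self]
    exact measurable_const.sub (Finset.measurable_sum _ fun i _ => measurable_pi_apply i)
  · simp only [sliceSwapMap_apply_ne x w _ h]
    exact measurable_pi_apply j

/-- `T_{x,w}` as a measurable equivalence (an involution). [folklore] -/
def sliceSwapEquiv (x : Fin (n + 1)) (w : ℝ) : (Fin (n + 1) → ℝ) ≃ᵐ (Fin (n + 1) → ℝ) where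
  toFun := sliceSwapMap x w
  invFun := sliceSwapMap x w
  left_inv := sliceSwapMap_involutive x w
  right_inv := sliceSwapMap_involutive x w
  measurable_toFun := measurable_sliceSwapMap x w
  measurable_invFun := measurable_sliceSwapMap x w

/-- **`T_{x,w}` preserves Lebesgue measure** (a shear in the coordinate `x` over the other
coordinates, followed by a reflection and a translation). [folklore] -/
theorem measurePreserving_sliceSwapMap (x : Fin (n + 1)) (w : ℝ) :
    MeasurePreserving (sliceSwapMap (n := n) x w) := by
  -- split off the coordinate `x`
  set e := MeasurableEquiv.piFinSuccAbove (fun _ : Fin (n + 1) => ℝ) x with he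
  have hme : MeasurePreserving e := volume_preserving_piFinSuccAbove (fun _ : Fin (n + 1) => ℝ) x
  -- the map in the coordinates `(t, v)`
  set S : ℝ × (Fin n → ℝ) → ℝ × (Fin n → ℝ) := fun p => (w - ∑ j, p.2 j - p.1, p.2) with hS
  have hS' : MeasurePreserving (fun p : (Fin n → ℝ) × ℝ => (p.1, (w - ∑ j, p.1 j) - p.2))
      ((volume : Measure (Fin n → ℝ)).prod volume) ((volume : Measure (Fin n → ℝ)).prod volume) := by
    have hsk := MeasurePreserving.skew_product (μc := (volume : Measure ℝ)) (μd := (volume : Measure ℝ))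
      (g := fun (v : Fin n → ℝ) (t : ℝ) => (w - ∑ j, v j) - t)
      (MeasurePreserving.id (volume : Measure (Fin n → ℝ))) ?_ ?_
    · simpa using hsk
    · exact (measurable_const.sub (Finset.measurable_sum _ fun i _ =>
        (measurable_pi_apply i).comp measurable_fst)).sub measurable_snd
    · exact Filter.Eventually.of_forall fun v =>
        (Measure.measurePreserving_sub_left volume (w - ∑ j, v j)).map_eq
  have hSm : MeasurePreserving S (volume : Measure (ℝ × (Fin n → ℝ))) volume := by
    have h1 : MeasurePreserving (Prod.swap : ℝ × (Fin n → ℝ) → (Fin n → ℝ) × ℝ)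
        ((volume : Measure ℝ).prod volume) ((volume : Measure (Fin n → ℝ)).prod volume) :=
      Measure.measurePreserving_swap
    have h2 : MeasurePreserving (Prod.swap : (Fin n → ℝ) × ℝ → ℝ × (Fin n → ℝ))
        ((volume : Measure (Fin n → ℝ)).prod volume) ((volume : Measure ℝ).prod volume) :=
      Measure.measurePreserving_swap
    have h3 := (h2.comp hS').comp h1
    have hSeq : S = (Prod.swap ∘ (fun p : (Fin n → ℝ) × ℝ => (p.1, (w - ∑ j, p.1 j) - p.2))) ∘ Prod.swap :=
      funext fun p => rfl
    rw [hSeq]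
    exact h3
  -- `T = e.symm ∘ S ∘ e`
  have heu : ∀ u : Fin (n + 1) → ℝ, e u = (u x, Fin.removeNth x u) := fun u => rfl
  have hcomp : sliceSwapMap (n := n) x w = e.symm ∘ S ∘ e := by
    funext u
    have hsum : ∑ i, u i = u x + ∑ j, u (x.succAbove j) := Fin.sum_univ_succAbove u x
    apply e.injective
    simp only [Function.comp, MeasurableEquiv.apply_symm_apply]
    rw [heu, heu, hS]
    refine Prod.ext ?_ ?_
    · simp only
      rw [sliceSwapMap_apply_self, hsum]
      simp only [Fin.removeNth]
      ring
    · funext j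
      simp only [Fin.removeNth]
      exact sliceSwapMap_apply_ne x w u (Fin.succAbove_ne x j)
  rw [hcomp]
  exact (MeasurePreserving.symm e hme).comp (hSm.comp hme)

/-! ### Invariance of slice integrals under permutations of the coordinates -/

/-- The slice condition is symmetric. [folklore] -/
theorem sliceCond_comp_equiv {m : ℕ} (u : Fin m → ℝ) (σ : Equiv.Perm (Fin m)) (w : ℝ) :
    ((∀ i, 0 < (u ∘ σ) i) ∧ ∑ i, (u ∘ σ) i < w) ↔ ((∀ i, 0 < u i) ∧ ∑ i, u i < w) := by
  have hs : ∑ i, (u ∘ σ) i = ∑ i, u i := Equiv.sum_comp σ u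
  rw [hs]
  constructor
  · rintro ⟨h1, h2⟩; exact ⟨fun i => by simpa using h1 (σ.symm i), h2⟩
  · rintro ⟨h1, h2⟩; exact ⟨fun i => h1 (σ i), h2⟩

/-- Swapping two free coordinates: the slice integrand transforms by the coordinate swap.
[folklore] -/
theorem sliceIntegrand_swap_castSucc {m : ℕ} (w : ℝ) (G : (Fin (m + 1) → ℝ) → ℝ) (x y : Fin m)
    (u : Fin m → ℝ) :
    sliceIntegrand m w (fun v => G (v ∘ Equiv.swap (Fin.castSucc x) (Fin.castSucc y))) u =
      sliceIntegrand m w G (u ∘ Equiv.swap x y) := by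
  unfold sliceIntegrand
  by_cases hu : (∀ i, 0 < u i) ∧ ∑ i, u i < w
  · rw [if_pos hu, if_pos ((sliceCond_comp_equiv u (Equiv.swap x y) w).2 hu)]
    have hsum : ∑ i, (u ∘ Equiv.swap x y) i = ∑ i, u i := Equiv.sum_comp (Equiv.swap x y) u
    rw [hsum]
    show G (Fin.snoc u (w - ∑ i, u i) ∘ Equiv.swap (Fin.castSucc x) (Fin.castSucc y)) = _
    congr 1
    funext i
    refine Fin.lastCases ?_ (fun j => ?_) i
    · simp only [Function.comp, Equiv.swap_apply_of_ne_of_ne (Fin.castSucc_lt_last x).ne'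
        (Fin.castSucc_lt_last y).ne', Fin.snoc_last]
    · simp only [Function.comp, Fin.castSucc_injective m |>.swap_apply x y j, Fin.snoc_castSucc]
  · rw [if_neg hu, if_neg (fun h => hu ((sliceCond_comp_equiv u (Equiv.swap x y) w).1 h))]

/-- Swapping a free coordinate with the dependent last one: the slice integrand transforms by the
measure-preserving map `T_{x,w}`. [folklore] -/
theorem sliceIntegrand_swap_last {m : ℕ} (w : ℝ) (G : (Fin (m + 2) → ℝ) → ℝ) (x : Fin (m + 1))
    (u : Fin (m + 1) → ℝ) :
    sliceIntegrand (m + 1) w (fun v => G (v ∘ Equiv.swap (Fin.castSucc x) (Fin.last (m + 1)))) u =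
      sliceIntegrand (m + 1) w G (sliceSwapMap x w u) := by
  have hcond : ((∀ i, 0 < sliceSwapMap x w u i) ∧ ∑ i, sliceSwapMap x w u i < w) ↔
      ((∀ i, 0 < u i) ∧ ∑ i, u i < w) := by
    constructor
    · rintro ⟨h1, h2⟩
      have hinv := sliceSwapMap_involutive x w u
      refine ⟨fun i => ?_, ?_⟩
      · rw [← hinv]
        by_cases hi : i = x
        · subst hi; rw [sliceSwapMap_apply_self, sum_sliceSwapMap]
          have := h1 i; rw [sliceSwapMap_apply_self] at this
          rw [sum_sliceSwapMap] at h2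
          have hx := h1 i
          linarith [hx]
        · rw [sliceSwapMap_apply_ne x w _ hi]; exact h1 i
      · rw [← hinv, sum_sliceSwapMap, sliceSwapMap_apply_self]
        have := h2; rw [sum_sliceSwapMap] at this
        have hx := h1 x; rw [sliceSwapMap_apply_self] at hx
        linarith
    · rintro ⟨h1, h2⟩
      refine ⟨fun i => ?_, ?_⟩
      · by_cases hi : i = x
        · subst hi; rw [sliceSwapMap_apply_self]; linarith
        · rw [sliceSwapMap_apply_ne x w _ hi]; exact h1 i
      · rw [sum_sliceSwapMap]; linarith [h1 x]
  unfold sliceIntegrand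
  by_cases hu : (∀ i, 0 < u i) ∧ ∑ i, u i < w
  · rw [if_pos hu, if_pos (hcond.2 hu)]
    show G (Fin.snoc u (w - ∑ i, u i) ∘ Equiv.swap (Fin.castSucc x) (Fin.last (m + 1))) = _
    congr 1
    funext i
    refine Fin.lastCases ?_ (fun j => ?_) i
    · simp only [Function.comp, Equiv.swap_apply_right, Fin.snoc_castSucc, Fin.snoc_last,
        sum_sliceSwapMap]
      ring
    · by_cases hj : j = x
      · subst hj
        simp only [Function.comp, Equiv.swap_apply_left, Fin.snoc_last, Fin.snoc_castSucc,
          sliceSwapMap_apply_self]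
      · simp only [Function.comp, Fin.snoc_castSucc]
        rw [Equiv.swap_apply_of_ne_of_ne (fun h => hj (Fin.castSucc_injective _ h))
          (Fin.castSucc_lt_last j).ne, Fin.snoc_castSucc, sliceSwapMap_apply_ne x w _ hj]
  · rw [if_neg hu, if_neg (fun h => hu (hcond.1 h))]

/-- `piCongrLeft` by `σ` is precomposition with `σ⁻¹`. [folklore] -/
theorem piCongrLeft_apply_eq {m : ℕ} (σ : Equiv.Perm (Fin m)) (u : Fin m → ℝ) :
    (MeasurableEquiv.piCongrLeft (fun _ : Fin m => ℝ) σ) u = u ∘ σ.symm := by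
  funext a
  have := MeasurableEquiv.piCongrLeft_apply_apply σ (β := fun _ : Fin m => ℝ) u (σ.symm a)
  simpa using this

/-- **Slice integrals are invariant under the swap of two coordinates.** [folklore] -/
theorem sliceIntegral_comp_swap {d : ℕ} (w : ℝ) (G : (Fin d → ℝ) → ℝ) {x y : Fin d} (hxy : x ≠ y) :
    sliceIntegral d w (fun v => G (v ∘ Equiv.swap x y)) = sliceIntegral d w G := by
  cases d with
  | zero => rfl
  | succ m =>
    rw [sliceIntegral_succ_eq, sliceIntegral_succ_eq]
    -- reduce to `y = last` or both free, using `swap_comm`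
    rcases Fin.eq_castSucc_or_eq_last x with ⟨x', rfl⟩ | rfl <;>
      rcases Fin.eq_castSucc_or_eq_last y with ⟨y', rfl⟩ | rfl
    · -- both free coordinates
      simp_rw [sliceIntegrand_swap_castSucc w G x' y']
      have hmp := volume_measurePreserving_piCongrLeft (fun _ : Fin m => ℝ) (Equiv.swap x' y')
      rw [← hmp.integral_comp' (f := MeasurableEquiv.piCongrLeft (fun _ : Fin m => ℝ) (Equiv.swap x' y'))]
      refine integral_congr_ae (Filter.Eventually.of_forall fun u => ?_)
      simp only [piCongrLeft_apply_eq, Equiv.symm_swap]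
      congr 1
      funext i
      simp [Function.comp, Equiv.swap_apply_self]
    · -- `y = last`, `x = castSucc x'`
      cases m with
      | zero => exact (Fin.elim0 x')
      | succ m' =>
        simp_rw [sliceIntegrand_swap_last w G x']
        exact (measurePreserving_sliceSwapMap x' w).integral_comp' (f := sliceSwapEquiv x' w)
          (sliceIntegrand (m' + 1) w G)
    · -- `x = last`, `y = castSucc y'`
      cases m with
      | zero => exact (Fin.elim0 y')
      | succ m' =>
        rw [Equiv.swap_comm]
        simp_rw [sliceIntegrand_swap_last w G y']
        exact (measurePreserving_sliceSwapMap y' w).integral_comp' (f := sliceSwapEquiv y' w)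
          (sliceIntegrand (m' + 1) w G)
    · exact absurd rfl hxy

/-- **Slice integrals are invariant under permutations of the coordinates.** [folklore] -/
theorem sliceIntegral_comp_perm {d : ℕ} (w : ℝ) (σ : Equiv.Perm (Fin d)) :
    ∀ G : (Fin d → ℝ) → ℝ, sliceIntegral d w (fun v => G (v ∘ σ)) = sliceIntegral d w G := by
  induction σ using Equiv.Perm.swap_induction_on with
  | one => intro G; rfl
  | swap_mul f x y hxy ih =>
    intro G
    have : (fun v : Fin d → ℝ => G (v ∘ ⇑(Equiv.swap x y * f))) =
        fun v => (fun u => G (u ∘ f)) (v ∘ Equiv.swap x y) := by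
      funext v; rfl
    rw [this, sliceIntegral_comp_swap w (fun u => G (u ∘ f)) hxy, ih G]

end Perm

end Literature.NumberTheory.Sieve.FordMaynard
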